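/-
# UCoord39 — the x ↔ u change of variables as an `Equiv`, and Lemma B″ (qa-qnc0-p1 g39, ROUND-38 §2)

Custody file (D-0168 E1): lives under `HOME/qa-qnc0-p1/exp39/`, farm `lean check` only.

Contents:
* `xOfU` (inverse of p2's `uCoord`: `x_i = ¬(u_i ⊕ u_{i-1})`, `u_{-1} := 0`), `xOfU_uCoord`, `uCoord_xOfU`,
  the equivalence `uEquiv : (Fin N → Bool) ≃ (Fin N → Bool)` (`uEquiv x = uCoord x`), the change of variables
  `sum_eq_sum_xOfU : ∑ x, F x = ∑ u, F (xOfU u)`, `Wk_xOfU` (prefix weights are prefix COUNTS of `u`), and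
  `oddZeros_iff_uCoord_last` (the odd class is `u_{N-1} = 1`).
* Lemma B″ of ROUND-38 §2 in the typed form `Blind39.LinBlindness` (v2, with `k ≤ N`).
-/
import Summits.QuantumAdvantage.AdviceFreeQNC0.RingHardOdd
import Summits.QuantumAdvantage.AdviceFreeQNC0.AffBells21Characters
import HarnessLib

namespace Summit.QuantumAdvantage.AdviceFreeQNC0.UCoord39

open Finset Summit.QuantumAdvantage.AdviceFreeQNC0 Literature.Computability.MetaComplexity

variable {N : ℕ}

/-! ## The inverse map and the equivalence -/

/-- `u_{i-1}`, with the convention `u_{-1} = false`. -/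
def uPrev (u : Fin N → Bool) (i : Fin N) : Bool :=
  if h : i.val = 0 then false else u ⟨i.val - 1, by omega⟩

/-- The inverse of `uCoord`: `x_i = ¬(u_i ⊕ u_{i-1})`. -/
def xOfU (u : Fin N → Bool) (i : Fin N) : Bool := !(xor (u i) (uPrev u i))

/-- auxiliary lemma `uPrev_of_zero` (planner p1 g39, exp39; ported verbatim). -/
theorem uPrev_of_zero (u : Fin N → Bool) (i : Fin N) (hi : i.val = 0) : uPrev u i = false := by
  unfold uPrev; rw [dif_pos hi]

/-- auxiliary lemma `uPrev_of_succ` (planner p1 g39, exp39; ported verbatim). -/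
theorem uPrev_of_succ (u : Fin N → Bool) (i j : Fin N) (h : j.val = i.val + 1) : uPrev u j = u i := by
  unfold uPrev
  rw [dif_neg (by omega)]
  congr 1
  exact Fin.ext (by simp; omega)

/-- `u_0 = ¬x_0`. -/
theorem uCoord_of_zero (x : Fin N → Bool) (i : Fin N) (hi : i.val = 0) : uCoord x i = !x i := by
  rw [uCoord_eq_zpar, hi, zpar_succ x (k := 0) (by omega), zpar_zero]
  have : (⟨0, by omega⟩ : Fin N) = i := Fin.ext (by simp [hi])
  rw [this]
  simp

/-- `u_{i+1} = u_i ⊕ ¬x_{i+1}`. -/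
theorem uCoord_of_succ (x : Fin N → Bool) (i j : Fin N) (h : j.val = i.val + 1) :
    uCoord x j = xor (uCoord x i) (!x j) := by
  rw [uCoord_eq_zpar, uCoord_eq_zpar, h, zpar_succ x (k := i.val + 1) (by omega)]
  have : (⟨i.val + 1, by omega⟩ : Fin N) = j := Fin.ext (by simp [h])
  rw [this]

/-- auxiliary lemma `xOfU_uCoord` (planner p1 g39, exp39; ported verbatim). -/
theorem xOfU_uCoord (x : Fin N → Bool) : xOfU (uCoord x) = x := by
  funext i
  unfold xOfU
  by_cases hi : i.val = 0
  · rw [uPrev_of_zero _ i hi, uCoord_of_zero x i hi]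
    cases x i <;> rfl
  · have hlt : i.val - 1 < N := by omega
    rw [uPrev_of_succ _ ⟨i.val - 1, hlt⟩ i (by simp; omega),
      uCoord_of_succ x ⟨i.val - 1, hlt⟩ i (by simp; omega)]
    cases uCoord x ⟨i.val - 1, hlt⟩ <;> cases x i <;> rfl

/-- auxiliary lemma `uCoord_xOfU` (planner p1 g39, exp39; ported verbatim). -/
theorem uCoord_xOfU (u : Fin N → Bool) : uCoord (xOfU u) = u := by
  funext i
  suffices h : ∀ n (hn : n < N), uCoord (xOfU u) ⟨n, hn⟩ = u ⟨n, hn⟩ from h i.val i.isLt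
  intro n
  induction n with
  | zero =>
    intro hn
    rw [uCoord_of_zero _ _ rfl]
    unfold xOfU
    rw [uPrev_of_zero _ _ rfl]
    cases u ⟨0, hn⟩ <;> rfl
  | succ n ih =>
    intro hn
    rw [uCoord_of_succ (xOfU u) ⟨n, by omega⟩ ⟨n + 1, hn⟩ rfl, ih (by omega)]
    unfold xOfU
    rw [uPrev_of_succ u ⟨n, by omega⟩ ⟨n + 1, hn⟩ rfl]
    cases u ⟨n, by omega⟩ <;> cases u ⟨n + 1, hn⟩ <;> rfl

/-- **The change of variables** `x ↦ u` as an equivalence of `Fin N → Bool`. -/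
def uEquiv : (Fin N → Bool) ≃ (Fin N → Bool) where
  toFun := uCoord
  invFun := xOfU
  left_inv := xOfU_uCoord
  right_inv := uCoord_xOfU

/-- auxiliary lemma `uEquiv_apply` (planner p1 g39, exp39; ported verbatim). -/
@[simp] theorem uEquiv_apply (x : Fin N → Bool) : uEquiv x = uCoord x := rfl
/-- auxiliary lemma `uEquiv_symm_apply` (planner p1 g39, exp39; ported verbatim). -/
@[simp] theorem uEquiv_symm_apply (u : Fin N → Bool) : uEquiv.symm u = xOfU u := rfl

/-- Sums over inputs `x` are sums over walks `u`. -/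
theorem sum_eq_sum_xOfU {M : Type*} [AddCommMonoid M] (F : (Fin N → Bool) → M) :
    ∑ x, F x = ∑ u, F (xOfU u) := by
  rw [← Equiv.sum_comp (uEquiv (N := N)).symm F]
  rfl

/-- In u-coordinates the prefix weight is a prefix count. -/
theorem Wk_xOfU (u : Fin N → Bool) (k : ℕ) :
    Wk (xOfU u) k = (univ.filter fun i : Fin N => i.val < k ∧ u i = true).card := by
  unfold Wk
  rw [uCoord_xOfU]

/-- The odd class is `u_{N-1} = 1`. -/
theorem oddZeros_iff_uCoord_last (hN : 0 < N) (x : Fin N → Bool) :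
    OddZeros x ↔ uCoord x ⟨N - 1, by omega⟩ = true := by
  rw [uCoord_eq_zpar]
  have h1 : N - 1 + 1 = N := by omega
  rw [h1]
  unfold OddZeros zpar
  have : (univ.filter fun j : Fin N => j.val < N ∧ x j = false) = univ.filter fun j : Fin N => x j = false := by
    ext j; simp
  rw [this, decide_eq_true_iff]

/-- `x_i` in u-coordinates reads only `u_i` and `u_{i-1}`. -/
theorem xOfU_congr (u u' : Fin N → Bool) (i : Fin N) (hi : u i = u' i)
    (hprev : ∀ j : Fin N, i.val = j.val + 1 → u j = u' j) : xOfU u i = xOfU u' i := by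
  unfold xOfU
  rw [hi]
  by_cases h0 : i.val = 0
  · rw [uPrev_of_zero _ _ h0, uPrev_of_zero _ _ h0]
  · have hlt : i.val - 1 < N := by omega
    rw [uPrev_of_succ u ⟨i.val - 1, hlt⟩ i (by simp; omega), uPrev_of_succ u' ⟨i.val - 1, hlt⟩ i (by simp; omega),
      hprev ⟨i.val - 1, hlt⟩ (by simp; omega)]

/-! ## Fubini over blind coordinates -/

/-- One coordinate: if `G` is blind to coordinate `j` then `2·Σ_u φ(u_j)·G(u) = (φ tt + φ ff)·Σ_u G(u)`. -/
theorem two_mul_sum_coord (j : Fin N) (φ : Bool → ℂ) (G : (Fin N → Bool) → ℂ)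
    (hG : ∀ (u : Fin N → Bool) (b : Bool), G (Function.update u j b) = G u) :
    2 * ∑ u : Fin N → Bool, φ (u j) * G u = (φ true + φ false) * ∑ u : Fin N → Bool, G u := by
  have hs : Function.Involutive (fun u : Fin N → Bool => Function.update u j (!u j)) := by
    intro u
    simp only [Function.update_self, Bool.not_not, Function.update_idem, Function.update_eq_self]
  have h1 : ∑ u : Fin N → Bool, φ (u j) * G u = ∑ u : Fin N → Bool, φ (!u j) * G u := by
    rw [← Equiv.sum_comp (hs.toPerm _) (fun u => φ (u j) * G u)]
    refine Fintype.sum_congr _ _ fun u => ?_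
    rw [Function.Involutive.coe_toPerm]
    show φ ((Function.update u j (!u j)) j) * G (Function.update u j (!u j)) = φ (!u j) * G u
    rw [Function.update_self, hG]
  rw [two_mul]
  nth_rewrite 2 [h1]
  rw [← Finset.sum_add_distrib, Finset.mul_sum]
  refine Finset.sum_congr rfl fun u _ => ?_
  rw [← add_mul]
  congr 1
  cases u j <;> simp [add_comm]

/-- Finitely many coordinates: if `G` is blind to every coordinate in `C` then
`2^{#C}·Σ_u (∏_{i∈C} φ(u_i))·G(u) = (φ tt + φ ff)^{#C}·Σ_u G(u)`. -/
theorem pow_mul_sum_prod_coord (C : Finset (Fin N)) (φ : Bool → ℂ) :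
    ∀ G : (Fin N → Bool) → ℂ, (∀ (u : Fin N → Bool) (j : Fin N) (b : Bool), j ∈ C → G (Function.update u j b) = G u) →
      (2 : ℂ) ^ C.card * ∑ u : Fin N → Bool, (∏ i ∈ C, φ (u i)) * G u
        = (φ true + φ false) ^ C.card * ∑ u : Fin N → Bool, G u := by
  classical
  induction C using Finset.induction_on with
  | empty =>
    intro G _
    simp
  | @insert j C hj ih =>
    intro G hG
    rw [Finset.card_insert_of_notMem hj]
    have hprod : ∀ u : Fin N → Bool, (∏ i ∈ insert j C, φ (u i)) * G u = (∏ i ∈ C, φ (u i)) * (φ (u j) * G u) := by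
      intro u
      rw [Finset.prod_insert hj, mul_assoc, mul_left_comm]
    rw [Fintype.sum_congr _ _ hprod]
    -- induction hypothesis applied to `G' u = φ(u_j)·G(u)`, which is blind to `C`
    have hG' : ∀ (u : Fin N → Bool) (i : Fin N) (b : Bool), i ∈ C →
        φ ((Function.update u i b) j) * G (Function.update u i b) = φ (u j) * G u := by
      intro u i b hi
      have hne : j ≠ i := fun h => hj (h ▸ hi)
      rw [Function.update_of_ne hne, hG u i b (Finset.mem_insert_of_mem hi)]
    have h1 := ih (fun u => φ (u j) * G u) hG'
    -- one more coordinate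
    have h2 := two_mul_sum_coord j φ G (fun u b => hG u j b (Finset.mem_insert_self j C))
    rw [pow_succ, pow_succ, mul_comm ((2 : ℂ) ^ C.card) 2, mul_assoc, h1, ← mul_assoc, mul_comm (2 : ℂ), mul_assoc, h2,
      ← mul_assoc]

/-- The norm form used below: `‖Σ_u (∏_{i∈C} φ(u_i))·G(u)‖ ≤ ‖φ tt + φ ff‖^{#C} · 2^N / 2^{#C}` when `‖G‖ ≤ 1`. -/
theorem norm_sum_prod_coord_le (C : Finset (Fin N)) (φ : Bool → ℂ) (G : (Fin N → Bool) → ℂ)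
    (hG : ∀ (u : Fin N → Bool) (j : Fin N) (b : Bool), j ∈ C → G (Function.update u j b) = G u)
    (hG1 : ∀ u, ‖G u‖ ≤ 1) :
    ‖∑ u : Fin N → Bool, (∏ i ∈ C, φ (u i)) * G u‖ ≤ ‖φ true + φ false‖ ^ C.card * (2 : ℝ) ^ N / (2 : ℝ) ^ C.card := by
  have h := pow_mul_sum_prod_coord C φ G hG
  have h2pos : (0 : ℝ) < (2 : ℝ) ^ C.card := by positivity
  rw [le_div_iff₀ h2pos]
  have hn : ‖(2 : ℂ) ^ C.card * ∑ u : Fin N → Bool, (∏ i ∈ C, φ (u i)) * G u‖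
      = ‖∑ u : Fin N → Bool, (∏ i ∈ C, φ (u i)) * G u‖ * (2 : ℝ) ^ C.card := by
    rw [norm_mul, norm_pow, Complex.norm_ofNat, mul_comm]
  rw [← hn, h, norm_mul, norm_pow]
  have hsum : ‖∑ u : Fin N → Bool, G u‖ ≤ (2 : ℝ) ^ N := by
    calc ‖∑ u : Fin N → Bool, G u‖ ≤ ∑ u : Fin N → Bool, ‖G u‖ := norm_sum_le _ _
      _ ≤ ∑ _u : Fin N → Bool, (1 : ℝ) := Finset.sum_le_sum fun u _ => hG1 u
      _ = (2 : ℝ) ^ N := by simp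
  exact mul_le_mul_of_nonneg_left hsum (by positivity)

/-! ## Lemma B″ (ROUND-38 §2): linear blindness, by Fubini over the clean u-coordinates -/

/-- `⟨β, x⟩ = Σ_{i : x_i = 1} β_i (mod 3)` (same definition as `Blind39.linVal` / `LinJunta39.linVal`). -/
def linVal (β : Fin N → ZMod 3) (x : Fin N → Bool) : ZMod 3 := ∑ i, if x i then β i else 0

/-- The CLEAN coordinates for `(k, r)`: `j < k`, `r_j = 0`, and `r_{j+1} = 0` (vacuous if `j+1 = N`). -/
def Clean (k : ℕ) (r : Fin N → ZMod 3) (j : Fin N) : Prop :=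
  j.val < k ∧ r j = 0 ∧ ∀ j' : Fin N, j'.val = j.val + 1 → r j' = 0

/-- decidability instance `instDecClean` (planner p1 g39, exp39; ported verbatim). -/
instance instDecClean (k : ℕ) (r : Fin N → ZMod 3) : DecidablePred (Clean k r) := by
  intro j; unfold Clean; infer_instance

/-- The part of the phase NOT carried by clean coordinates. -/
def rest (k : ℕ) (r : Fin N → ZMod 3) (a b : ZMod 3) (u : Fin N → Bool) : ZMod 3 :=
  (∑ i : Fin N, if (¬ Clean k r i ∧ (i.val < k ∧ u i = true)) then a else 0) + b * linVal r (xOfU u)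

/-- auxiliary lemma `count_cast` (planner p1 g39, exp39; ported verbatim). -/
theorem count_cast (u : Fin N → Bool) (k : ℕ) :
    (((univ.filter fun i : Fin N => i.val < k ∧ u i = true).card : ℕ) : ZMod 3)
      = ∑ i : Fin N, if (i.val < k ∧ u i = true) then (1 : ZMod 3) else 0 := by
  rw [Finset.card_filter, Nat.cast_sum]
  refine Finset.sum_congr rfl fun i _ => ?_
  split_ifs <;> simp

/-- Splitting the u-coordinate phase into the clean part and the rest. -/
theorem phase_split (k : ℕ) (r : Fin N → ZMod 3) (a b : ZMod 3) (u : Fin N → Bool) :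
    a * (((univ.filter fun i : Fin N => i.val < k ∧ u i = true).card : ℕ) : ZMod 3) + b * linVal r (xOfU u)
      = (∑ i : Fin N, if u i then (if Clean k r i then a else 0) else 0) + rest k r a b u := by
  rw [count_cast, Finset.mul_sum]
  have h : ∀ i : Fin N, a * (if (i.val < k ∧ u i = true) then (1 : ZMod 3) else 0)
      = (if u i then (if Clean k r i then a else 0) else 0)
        + (if (¬ Clean k r i ∧ (i.val < k ∧ u i = true)) then a else 0) := by
    intro i
    by_cases hc : Clean k r i
    · have hik : i.val < k := hc.1
      cases u i <;> simp [hc, hik]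
    · cases u i <;> simp [hc]
  rw [Fintype.sum_congr _ _ h, Finset.sum_add_distrib, rest, add_assoc]

/-- The clean part of the phase is a product of one-coordinate factors. -/
theorem std_cleanPart (k : ℕ) (r : Fin N → ZMod 3) (a : ZMod 3) (u : Fin N → Bool) :
    (ZMod.stdAddChar (∑ i : Fin N, if u i then (if Clean k r i then a else 0) else 0) : ℂ)
      = ∏ i ∈ univ.filter (Clean k r), (if u i then (ZMod.stdAddChar a : ℂ) else 1) := by
  rw [TwoModuli.stdAddChar_sum_ite (fun i => if Clean k r i then a else 0) u, Finset.prod_filter]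
  refine Finset.prod_congr rfl fun i _ => ?_
  by_cases hc : Clean k r i
  · simp [hc]
  · cases u i <;> simp [hc]

end Summit.QuantumAdvantage.AdviceFreeQNC0.UCoord39
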